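import Literature.IUT.HodgeTheaters.ThetaHodgeTheatersRemarksA2
import Literature.AlgebraicGeometry.Frobenioids.ModelFrobenioid
import HarnessLib

/-!
# [IUTchI] Rmk 3.2.3 (ii): NON-VACUITY of the interface `S3RemarksLocal.BiratUnits` at the MODEL FROBENIOID

S. Mochizuki, *Inter-universal Teichmüller theory I*, §3, Remark 3.2.3 (ii) (kurims final manuscript
May 2020, p. 75): "Suppose … that `ψ : B → T_A` is a linear morphism in the Frobenioid `F̲_v`.  Then `ψ`
induces an injective homomorphism `𝒪^×(T_A^÷) ↪ 𝒪^×(B^÷)` [cf. [FrdI], Proposition 1.11, (iv)]"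
[cite: Mochizuki2012, Rmk 3.2.3 (ii) p.75] [claim: Mochizuki2012, status: disputed]; the model Frobenioid
and the identification `𝒪^×(A^birat) ≅ B(A_D)` are [FrdI] Thm. 5.2 (i), (ii), kurims text pp. 100–101
[cite: MochizukiFrdI2008, Thm. 5.2(i) p.100].

PROOF-ONLY non-vacuity file (abc-iut cell, seat abc-iut-L6-t15 gen 4; row family «NV-L5/<Interface>»,
abc-iut-L5-lead RULINGS #27; interface typed by abc-iut-L3-t8 in `ThetaHodgeTheatersRemarksA2.lean`).
No `def`, `instance` or `structure` is declared: every witness is built inside a theorem term.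

WHAT IS WITNESSED.  `S3RemarksLocal.BiratUnits F` records, for a category `F`, a class of "linear"
morphisms, the groups `𝒪^×(A^÷)` and their contravariant pull-backs — no law.  Its bare inhabitation is
therefore trivial; the content of this file is the instantiation at the MODEL FROBENIOID of [FrdI]
Thm. 5.2 (i) (abc-iut-L1-t2's REAL category `ModelFrobenioid Φ B DivB` over a base category `D`, a
divisor monoid `Φ`, a rational-function monoid `B` and `Div_B : B → Φ^gp`):

* `S3RemarksLocal.BiratUnits.nonempty_model` — `IsLinear φ :↔ deg_Fr(φ) = 1` ([FrdI] Def. 1.2 (iii),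
  verbatim the definition used by abc-iut-L1's `PreFrobenioid.IsLinear`), `units A := B(A_D)ˣ` (by
  [FrdI] Thm. 5.2 (ii) "`𝒪^×(A^birat) ≅ B(A_D)`" for group-like `B`; for a general monoid `B` we take its
  units), `pull φ := B(Base φ)` restricted to units;
* `S3RemarksLocal.BiratUnits.model_pull_id` / `model_pull_comp` — the pull-backs of the model ARE
  functorial (the interface does not ask for it; the model has it);
* `S3RemarksLocal.BiratUnits.model_injectiveAlongLinear_iff` — at the model, the typed predicate
  `InjectiveAlongLinear` (FACT-LIST F-0751, [IUTchI] Rmk 3.2.3 (ii) / [FrdI] Prop. 1.11 (iv)) SAYS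
  exactly: `B(Base φ)` is injective on units for every morphism of Frobenius degree `1`;
* `S3RemarksLocal.BiratUnits.model_injectiveAlongLinear_of_injective` — hence it HOLDS at the model
  whenever the rational-function monoid `B` has injective transition maps (the situation of every
  geometric example: pull-back of rational functions along dominant maps is injective).  This is an
  honest CONDITIONAL discharge at the model, hypothesis named; `InjectiveAlongLinear` is NOT automatic
  for an arbitrary `B` and is not asserted in general.

HONEST LABEL: `_model` = the model Frobenioid of [FrdI] §5 (the object [IUTchI] Example 3.2's `F̲_v` is an
instance of, via abc-iut-L5-t2's `BadLocalFrobenioid`); not a scheme.  Nothing here takes a side on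
[IUTchIII] Cor. 3.12 (nor asserts anything of [IUTchI]); instantiated ≠ endorsed.
-/

noncomputable section

namespace Literature.IUT.HodgeTheaters

open CategoryTheory Opposite
open Literature.AlgebraicGeometry.Frobenioids

universe w v u

variable {D : Type u} [Category.{v} D] (Φ B : Dᵒᵖ ⥤ CommMonCat.{w}) (DivB : B ⟶ monoidGp Φ)

/-- **NV-L5 / [IUTchI] Rmk 3.2.3 (ii) — MODEL.**  The interface `S3RemarksLocal.BiratUnits` is
inhabited over the model Frobenioid `ModelFrobenioid Φ B DivB` of [FrdI] Thm. 5.2 (i): linear = Frobenius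
degree `1`, `𝒪^×(A^÷) := B(A_D)ˣ` ([FrdI] Thm. 5.2 (ii)), pull-back along `φ` = `B(Base φ)` on units.
Witness built inside the term; no definition declared. [cite: Mochizuki2012, Rmk 3.2.3 (ii) p.75] -/
theorem S3RemarksLocal.BiratUnits.nonempty_model :
    ∃ U : S3RemarksLocal.BiratUnits (ModelFrobenioid Φ B DivB),
      U = { IsLinear := fun φ => ModelFrobenioid.degFr φ = 1
            units := fun X => (B.obj (op X.base))ˣ
            pull := fun φ => Units.map (B.map (ModelFrobenioid.baseMap φ).op).hom } :=
  ⟨_, rfl⟩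

/-- The bare `Nonempty` form of `nonempty_model` (§4(iii) census: the type is inhabited over every model
Frobenioid). [cite: Mochizuki2012, Rmk 3.2.3 (ii) p.75] -/
theorem S3RemarksLocal.BiratUnits.nonempty :
    Nonempty (S3RemarksLocal.BiratUnits.{max u w, max v w, w} (ModelFrobenioid Φ B DivB)) :=
  let ⟨U, _⟩ := S3RemarksLocal.BiratUnits.nonempty_model Φ B DivB
  ⟨U⟩

/-- The model's pull-back along an identity is the identity (functoriality, not demanded by the
interface). [cite: MochizukiFrdI2008, Thm. 5.2(i) p.100] -/
theorem S3RemarksLocal.BiratUnits.model_pull_id (X : ModelFrobenioid Φ B DivB) :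
    let U : S3RemarksLocal.BiratUnits (ModelFrobenioid Φ B DivB) :=
      { IsLinear := fun φ => ModelFrobenioid.degFr φ = 1
        units := fun X => (B.obj (op X.base))ˣ
        pull := fun φ => Units.map (B.map (ModelFrobenioid.baseMap φ).op).hom }
    U.pull (𝟙 X) = MonoidHom.id _ := by
  intro U
  change Units.map (B.map (ModelFrobenioid.baseMap (𝟙 X)).op).hom = MonoidHom.id _
  rw [ModelFrobenioid.baseMap_id, op_id, B.map_id]
  ext u
  rfl

/-- The model's pull-backs compose (contravariantly): `pull (φ ≫ ψ) = pull φ ∘ pull ψ`.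
[cite: MochizukiFrdI2008, Thm. 5.2(i) p.100] -/
theorem S3RemarksLocal.BiratUnits.model_pull_comp {X Y Z : ModelFrobenioid Φ B DivB}
    (φ : X ⟶ Y) (ψ : Y ⟶ Z) :
    let U : S3RemarksLocal.BiratUnits (ModelFrobenioid Φ B DivB) :=
      { IsLinear := fun φ => ModelFrobenioid.degFr φ = 1
        units := fun X => (B.obj (op X.base))ˣ
        pull := fun φ => Units.map (B.map (ModelFrobenioid.baseMap φ).op).hom }
    U.pull (φ ≫ ψ) = (U.pull φ).comp (U.pull ψ) := by
  intro U
  change Units.map (B.map (ModelFrobenioid.baseMap (φ ≫ ψ)).op).hom =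
    (Units.map (B.map (ModelFrobenioid.baseMap φ).op).hom).comp
      (Units.map (B.map (ModelFrobenioid.baseMap ψ).op).hom)
  rw [ModelFrobenioid.baseMap_comp, op_comp, B.map_comp, ← Units.map_comp]
  rfl

/-- **[IUTchI] Rmk 3.2.3 (ii) / F-0751 `InjectiveAlongLinear` READ AT THE MODEL**: the typed predicate
says exactly that `B(Base φ)` is injective on units for every morphism `φ` of Frobenius degree `1`.
[cite: Mochizuki2012, Rmk 3.2.3 (ii) p.75] -/
theorem S3RemarksLocal.BiratUnits.model_injectiveAlongLinear_iff :
    let U : S3RemarksLocal.BiratUnits (ModelFrobenioid Φ B DivB) :=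
      { IsLinear := fun φ => ModelFrobenioid.degFr φ = 1
        units := fun X => (B.obj (op X.base))ˣ
        pull := fun φ => Units.map (B.map (ModelFrobenioid.baseMap φ).op).hom }
    InjectiveAlongLinear U ↔
      ∀ {X Y : ModelFrobenioid Φ B DivB} (φ : X ⟶ Y), ModelFrobenioid.degFr φ = 1 →
        Function.Injective (Units.map (B.map (ModelFrobenioid.baseMap φ).op).hom) :=
  Iff.rfl

/-- **[IUTchI] Rmk 3.2.3 (ii) at the MODEL, conditional discharge**: if the rational-function monoid `B`
has injective transition maps (pull-back of rational functions is injective — the geometric situation),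
then `InjectiveAlongLinear` HOLDS for the model Frobenioid (indeed along every morphism, linear or not).
Hypothesis named; nothing asserted for general `B`. [cite: Mochizuki2012, Rmk 3.2.3 (ii) p.75] -/
theorem S3RemarksLocal.BiratUnits.model_injectiveAlongLinear_of_injective
    (hB : ∀ {P Q : D} (f : P ⟶ Q), Function.Injective (B.map f.op).hom) :
    let U : S3RemarksLocal.BiratUnits (ModelFrobenioid Φ B DivB) :=
      { IsLinear := fun φ => ModelFrobenioid.degFr φ = 1
        units := fun X => (B.obj (op X.base))ˣ
        pull := fun φ => Units.map (B.map (ModelFrobenioid.baseMap φ).op).hom }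
    InjectiveAlongLinear U := by
  intro U X Y φ _
  exact Units.map_injective (hB (ModelFrobenioid.baseMap φ))

end Literature.IUT.HodgeTheaters

end
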